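import Summits.QuantumFields.YangMills.Theorems.LuscherReductionRunningReductionAxialSchur
import Summits.QuantumFields.YangMills.Theorems.LuscherReductionRunningReductionAxialConj
import Summits.QuantumFields.YangMills.Theorems.LuscherReductionRunningReductionCoarseUpperScales
import HarnessLib

/-!
# VALLEY GAIN and INNER NO-INTRUDER in axial gauge: both target texts of COARSE-UPPER(L) restated on `SU(2)^{2L³+1}` with the axial kernel
# (fixed-lattice programme COARSE(L₀) — route `LuscherReduction`, crux RED stmt-QuantumFields-19978 KT-door 3b′ / crux `TwistedTraceScaling`
# stmt-QuantumFields-20203 S-BASE; design note `pub/ym-fleet/ym-luscher-20007-p1/COARSE-DESIGN.md` §9–§10)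

With `qform_eq_axial` / `l2_eq_axial` (`…AxialGauge`) and the weighted Schur door `qform_le_of_axialRow` (`…AxialSchur`) the two OPEN targets of
`coarseNoIntruderAt_of_valley_oneOrbit_pow` become statements about functions of the NON-TREE LINKS only, with the kernel `A_β = axialKernel β` — no gauge
invariance left to handle:
* (`glue_conj'` of `…AxialConj`, `glue_comp_conj`) `valleyRegion δ η = {w | S(glue w) < 2η ∧ ∀ z, δ/2 < orbitDist(τ_z (glue w))}` — measurable, invariant under global conjugation;
  `ValleyRowBoundAt L δ η` — **C3 in axial form**: for every `A`, eventually in `β`, SOME measurable `Ad`-invariant weight `h` with `0 < c ≤ h ≤ C` satisfies the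
  row bound `∫_{valleyRegion} A_β(w,w') h(w') dw' ≤ e^{−Aλ_b(L³β)} λ₀(β,L) h(w)` on the valley region;
  ★ `valleyGainAt_of_rowBound : ValleyRowBoundAt L δ η → ValleyGainAt L δ η`;
* `InnerNoIntruderAxialAt L δ` — **C4 in axial form**: the min–max statement of `InnerNoIntruderOneOrbitAt` for families `g₀…g_k` of bounded measurable
  `Ad`-invariant functions on `SU(2)^{off}` supported in the comb box `‖w_i − 1‖_F ≤ (6L+1)δ`, with `⟨·,A_β·⟩` and `∫(·)²` in place of `qform`, `l2`;
  ★ `innerNoIntruderOneOrbitAt_of_axial : InnerNoIntruderAxialAt L δ → InnerNoIntruderOneOrbitAt L δ`.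
Hence (`coarseNoIntruderAt_of_axial_pow`) COARSE-UPPER(L) ⇐ `ValleyRowBoundAt L (powScale p) (powScale p)` + `InnerNoIntruderAxialAt L (powScale p)`, `0 < p < 1/3`.
HONEST FRAMING: interface bookkeeping; the two axial statements are OPEN (C3 L/XL, C4 XL); femto rung R2b1; not infinite volume, not a gap, not Clay.
-/

set_option autoImplicit false

noncomputable section

open MeasureTheory Filter Topology Real
open scoped Matrix ComplexConjugate BigOperators Matrix.Norms.Frobenius
open Literature.MathematicalPhysics.QuantumFieldTheory
open Literature.MathematicalPhysics.QuantumLattice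

namespace Summit.QuantumFields.YangMills.Theorems.FemtoTransferGap

variable {L : ℕ} [NeZero L]

/-! ## §1 Global conjugation of the non-tree links -/

omit [NeZero L] in
/-- A gauge-invariant function read through `glue` is `Ad`-invariant. [folklore] -/
theorem glue_comp_conj {α : Type*} {G : GaugeConfig 3 L SU2 → α} (hG : ∀ (g : Site 3 L → SU2) (U : GaugeConfig 3 L SU2), G (gaugeTransform g U) = G U)
    (k : SU2) (w : OffIdx L → SU2) : G (glue fun i : OffIdx L => k * w i * k⁻¹) = G (glue w) := by
  rw [glue_conj', hG]

/-! ## §2 The valley region in axial coordinates and the C3 door -/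

/-- **Valley region of the non-tree links**: `S(glue w) < 2η` and every twisted orbit distance of `glue w` is `> δ/2`. [folklore] -/
def valleyRegion (δ η : ℝ) : Set (OffIdx L → SU2) :=
  {w | wilsonAction su2Rep (glue w) < 2 * η ∧ ∀ z : Fin 3 → Bool, δ / 2 < orbitDist (TT.twist3 z (glue w))}

/-- The valley region is measurable. [folklore] -/
theorem measurableSet_valleyRegion (δ η : ℝ) : MeasurableSet (valleyRegion (L := L) δ η) := by
  haveI : SecondCountableTopology SU2 := secondCountableTopology_su2
  have hS : Measurable fun w : OffIdx L → SU2 => wilsonAction su2Rep (glue w) :=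
    (continuous_wilsonAction su2Rep continuous_su2Rep).measurable.comp measurable_glue
  have hO : ∀ z : Fin 3 → Bool, Measurable fun w : OffIdx L → SU2 => orbitDist (TT.twist3 z (glue w)) := fun z =>
    (measurable_orbitDist_twist3 z).comp measurable_glue
  have h : valleyRegion (L := L) δ η = {w | wilsonAction su2Rep (glue w) < 2 * η} ∩ ⋂ z : Fin 3 → Bool, {w | δ / 2 < orbitDist (TT.twist3 z (glue w))} := by
    ext w; simp [valleyRegion]
  rw [h]
  exact (measurableSet_lt hS measurable_const).inter (MeasurableSet.iInter fun z => measurableSet_lt measurable_const (hO z))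

/-- The valley region is invariant under global conjugation. [folklore] -/
theorem conj_mem_valleyRegion_iff (δ η : ℝ) (k : SU2) (w : OffIdx L → SU2) :
    (fun i : OffIdx L => k * w i * k⁻¹) ∈ valleyRegion (L := L) δ η ↔ w ∈ valleyRegion δ η := by
  simp only [valleyRegion, Set.mem_setOf_eq]
  rw [glue_conj', wilsonAction_gaugeTransform]
  refine and_congr Iff.rfl (forall_congr' fun z => ?_)
  rw [← TT.gaugeTransform_twist3, orbitDist_gaugeTransform]

variable (L) in
/-- **C3 in axial form — VALLEY ROW BOUND at scales `(δ, η)`** (OPEN, L/XL): for every `A`, eventually in `β`, there is a measurable weight `h` on the non-tree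
links, invariant under global conjugation, with `0 < c ≤ h ≤ C`, such that the axial kernel restricted to the valley region satisfies the ROW super-solution
bound `∫_{valley} A_β(w,w') h(w') dw' ≤ e^{−A·λ_b(L³β)}·λ₀(β,L)·h(w)` at every `w` of the valley region.  Target text of this programme (the weight is the
semiclassical ansatz: stiff Gaussian ground state × transverse zero-point profile along the toron valley; Lüscher 1983 §3), not a published theorem. -/
def ValleyRowBoundAt (δ η : ℝ → ℝ) : Prop :=
  ∀ A : ℝ, ∃ β0 : ℝ, ∀ β : ℝ, β0 ≤ β →
    ∃ (h : (OffIdx L → SU2) → ℝ) (c C : ℝ), Measurable h ∧ 0 < c ∧ (∀ w, c ≤ h w) ∧ (∀ w, h w ≤ C) ∧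
      (∀ (k : SU2) (w : OffIdx L → SU2), h (fun i => k * w i * k⁻¹) = h w) ∧
      ∀ w ∈ valleyRegion (L := L) (δ β) (η β),
        ∫ w', (valleyRegion (L := L) (δ β) (η β)).indicator (fun w' => axialKernel β w w' * h w') w' ∂(Measure.pi fun _ : OffIdx L => haarProbability SU2)
          ≤ Real.exp (-(A * bareLambda ((L : ℝ) ^ 3 * β))) * levelValue su2Rep L β 0 * h w

/-- ★★ **VALLEY GAIN from a valley row bound**: `ValleyRowBoundAt L δ η → ValleyGainAt L δ η`. [cite: Grafakos2009, App. A.2] -/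
theorem valleyGainAt_of_rowBound {δ η : ℝ → ℝ} (hV : ValleyRowBoundAt L δ η) : ValleyGainAt L δ η := by
  intro A
  obtain ⟨β0, hβ0⟩ := hV A
  refine ⟨max β0 0, fun β hβ φ hφ hsupp => ?_⟩
  have hβ' : β0 ≤ β := (le_max_left _ _).trans hβ
  have hβ0' : 0 ≤ β := (le_max_right _ _).trans hβ
  obtain ⟨h, c, C, hhm, hc, hch, hhC, hhA, hrow⟩ := hβ0 β hβ'
  obtain ⟨CG, hCG⟩ := hφ.bounded
  have hsupp' : ∀ w : OffIdx L → SU2, φ (glue w) ≠ 0 → w ∈ valleyRegion (L := L) (δ β) (η β) := fun w hw => hsupp (glue w) hw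
  have := qform_le_of_axialRow hβ0' hφ.measurable hCG hφ.gaugeInv (measurableSet_valleyRegion (δ β) (η β))
    (conj_mem_valleyRegion_iff (δ β) (η β)) hsupp' hhm hc hch hhC hhA hrow
  linarith [this]

/-! ## §3 INNER NO-INTRUDER in axial coordinates and the C4 door -/

variable (L) in
/-- **C4 in axial form — INNER NO-INTRUDER for the axial kernel at scale `δ`** (OPEN, XL).  For every `k`, `ε > 0`, eventually in `β`: every family
`g₀ … g_k` of bounded measurable functions of the non-tree links, invariant under global conjugation and supported in the comb box `‖w_i − 1‖_F ≤ (6L+1)·δ(β)`,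
with nondegenerate Gram matrix in `L²(Haar^{off})`, has a nonzero combination `u = Σ aᵢgᵢ` with `⟨u, A_β u⟩·μ₀ ≤ e^{ελ_b(L³β)}·μ_k·λ₀(β,L)·‖u‖²`
(`μ_j` = one-site levels at `B' = L³β`).  Target text (Born–Oppenheimer projection in axial gauge; Lüscher 1983 §3), not a published theorem. -/
def InnerNoIntruderAxialAt (δ : ℝ → ℝ) : Prop :=
  ∀ k : ℕ, ∀ ε : ℝ, 0 < ε → ∃ β0 : ℝ, ∀ β : ℝ, β0 ≤ β →
    ∀ g : Fin (k + 1) → ((OffIdx L → SU2) → ℝ),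
      (∀ i, Measurable (g i)) → (∀ i, ∃ C : ℝ, ∀ w, |g i w| ≤ C) →
      (∀ i (k' : SU2) (w : OffIdx L → SU2), g i (fun j => k' * w j * k'⁻¹) = g i w) →
      (∀ i w, g i w ≠ 0 → ∀ j : OffIdx L, frobNorm ((w j : Matrix (Fin 2) (Fin 2) ℂ) - 1) ≤ (6 * L + 1) * δ β) →
      (∀ a : Fin (k + 1) → ℝ, a ≠ 0 → 0 < ∫ w, (∑ i, a i * g i w) * (∑ i, a i * g i w) ∂(Measure.pi fun _ : OffIdx L => haarProbability SU2)) →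
        ∃ a : Fin (k + 1) → ℝ, a ≠ 0 ∧
          (∫ w, ∫ w', (∑ i, a i * g i w) * axialKernel β w w' * (∑ i, a i * g i w')
              ∂(Measure.pi fun _ : OffIdx L => haarProbability SU2) ∂(Measure.pi fun _ : OffIdx L => haarProbability SU2)) *
            levelValue su2Rep 1 ((L : ℝ) ^ 3 * β) 0 ≤
          Real.exp (ε * bareLambda ((L : ℝ) ^ 3 * β)) * levelValue su2Rep 1 ((L : ℝ) ^ 3 * β) k * levelValue su2Rep L β 0 *
            ∫ w, (∑ i, a i * g i w) * (∑ i, a i * g i w) ∂(Measure.pi fun _ : OffIdx L => haarProbability SU2)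

/-- ★★ **INNER NO-INTRUDER (one-orbit) from its axial form**: `InnerNoIntruderAxialAt L δ → InnerNoIntruderOneOrbitAt L δ`. [cite: SeilerLNP1982, §3] -/
theorem innerNoIntruderOneOrbitAt_of_axial {δ : ℝ → ℝ} (hI : InnerNoIntruderAxialAt L δ) : InnerNoIntruderOneOrbitAt L δ := by
  intro k ε hε
  obtain ⟨β0, hβ0⟩ := hI k ε hε
  refine ⟨max β0 0, fun β hβ G hGm hGb hGg hGs hGram => ?_⟩
  have hβ' : β0 ≤ β := (le_max_left _ _).trans hβ
  have hβ0' : 0 ≤ β := (le_max_right _ _).trans hβ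
  -- the axial family
  set g : Fin (k + 1) → (OffIdx L → SU2) → ℝ := fun i w => G i (glue w) with hgdef
  have hgm : ∀ i, Measurable (g i) := fun i => (hGm i).comp measurable_glue
  have hgb : ∀ i, ∃ C : ℝ, ∀ w, |g i w| ≤ C := fun i => by obtain ⟨C, hC⟩ := hGb i; exact ⟨C, fun w => hC _⟩
  have hgA : ∀ i (k' : SU2) (w : OffIdx L → SU2), g i (fun j => k' * w j * k'⁻¹) = g i w := fun i k' w => glue_comp_conj (hGg i) k' w
  have hgs : ∀ i w, g i w ≠ 0 → ∀ j : OffIdx L, frobNorm ((w j : Matrix (Fin 2) (Fin 2) ℂ) - 1) ≤ (6 * L + 1) * δ β :=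
    fun i w hw j => glue_support_of_orbitDist (hGs i) hw j
  -- combinations: gauge invariant, bounded, measurable; their norms and forms in axial coordinates
  choose Cb hCb using hGb
  have hcomb : ∀ a : Fin (k + 1) → ℝ,
      (Measurable fun U => ∑ i, a i * G i U) ∧ (∀ U, |∑ i, a i * G i U| ≤ ∑ i, |a i| * Cb i) ∧
      (∀ (g' : Site 3 L → SU2) (U : GaugeConfig 3 L SU2), (∑ i, a i * G i (gaugeTransform g' U)) = ∑ i, a i * G i U) := by
    intro a
    refine ⟨Finset.measurable_sum _ fun i _ => (hGm i).const_mul _, fun U => ?_, fun g' U => Finset.sum_congr rfl fun i _ => by rw [hGg i]⟩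
    refine (Finset.abs_sum_le_sum_abs _ _).trans (Finset.sum_le_sum fun i _ => ?_)
    rw [abs_mul]; exact mul_le_mul_of_nonneg_left (hCb i U) (abs_nonneg _)
  have hl2 : ∀ a : Fin (k + 1) → ℝ, l2 (fun U => ∑ i, a i * G i U) (fun U => ∑ i, a i * G i U) =
      ∫ w, (∑ i, a i * g i w) * (∑ i, a i * g i w) ∂(Measure.pi fun _ : OffIdx L => haarProbability SU2) := fun a => by
    obtain ⟨hm, -, hg'⟩ := hcomb a
    exact l2_eq_axial hm hg'
  have hq : ∀ a : Fin (k + 1) → ℝ, qform su2Rep β (fun U => ∑ i, a i * G i U) (fun U => ∑ i, a i * G i U) =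
      ∫ w, ∫ w', (∑ i, a i * g i w) * axialKernel β w w' * (∑ i, a i * g i w')
        ∂(Measure.pi fun _ : OffIdx L => haarProbability SU2) ∂(Measure.pi fun _ : OffIdx L => haarProbability SU2) := fun a => by
    obtain ⟨hm, hb, hg'⟩ := hcomb a
    exact qform_eq_axial hβ0' hm hb hg'
  have hGram' : ∀ a : Fin (k + 1) → ℝ, a ≠ 0 →
      0 < ∫ w, (∑ i, a i * g i w) * (∑ i, a i * g i w) ∂(Measure.pi fun _ : OffIdx L => haarProbability SU2) := fun a ha => by
    rw [← hl2 a]; exact hGram a ha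
  obtain ⟨a, ha, hIa⟩ := hβ0 β hβ' g hgm hgb hgA hgs hGram'
  refine ⟨a, ha, ?_⟩
  rw [hq a, hl2 a]
  exact hIa

/-! ## §4 COARSE-UPPER(L) from the two axial statements -/

/-- ★★★ **COARSE-UPPER(L) from the axial VALLEY ROW BOUND and the axial INNER NO-INTRUDER at the polynomial scales `β^{−p}`, `0 < p < 1/3`**
(conclusion = VERBATIM the body of KTR's `CoarseNoIntruderAt L`; `L = 2` is stub 3b′). [cite: Luscher1983, §3] [cite: LuscherMunster1984, §2] -/
theorem coarseNoIntruderAt_of_axial_pow {p : ℝ} (hp0 : 0 < p) (hp : p < 1 / 3)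
    (hV : ValleyRowBoundAt L (powScale p) (powScale p)) (hI : InnerNoIntruderAxialAt L (powScale p)) :
    ∀ k : ℕ, ∀ d : ℝ, d < levelGap k → ∃ lam0 : ℝ, 0 < lam0 ∧ ∀ lam : ℝ, 0 < lam → lam ≤ lam0 →
      ∀ β : ℝ, InFemtoWindow lam β L →
        levelValue su2Rep L β k ≤ Real.exp (-(d * luscherLambda β L) / L) * levelValue su2Rep L β 0 :=
  coarseNoIntruderAt_of_valley_oneOrbit_pow hp0 hp (valleyGainAt_of_rowBound hV) (innerNoIntruderOneOrbitAt_of_axial hI)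

end Summit.QuantumFields.YangMills.Theorems.FemtoTransferGap

end
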